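import Literature.Computability.MetaComplexity.SumOfSquares
import HarnessLib

/-!
# Degree-`d` Sum-of-Squares blindness for Boolean polynomial systems; symmetric-design systems

Trunk Literature/Computability/MetaComplexity; definition item `defn-designSystem` (route
PneNP/BruckRyserSos, whose items inline both notions verbatim; the generic notion is also wanted
by routes DelsarteLasserre / LatticeMagic / HeisenbergSparsestCut), in the pseudoexpectation
vocabulary of `SumOfSquares.lean` (`IsPseudoexpectation`, `SatisfiesIdentity`, `boolAxiom`;
Kothari–Mori–O'Donnell–Witmer 2017, Defs. 2.7–2.8 and §2.3).

* `PolySystemSosBlind d S` — **degree-`d` SOS fails to refute the Boolean polynomial system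
  `S ⊆ ℝ[x_0, x_1, …]`**: some degree-`d` pseudoexpectation satisfies every Booleanity identity
  `x_w² - x_w = 0` (`w : ℕ`) and every identity `q = 0`, `q ∈ S` (KMOW §2.3: the degree-`d` SOS
  relaxation of "a feasibility problem … asks if there is a degree-`d` pseudoexpectation
  satisfying certain polynomial equality constraints"; by SOS/SDP duality on the hypercube this is
  the non-existence of a degree-`d` SOS refutation and, as in `SumOfSquares.lean`, the primal form
  is the definition). `SOSFailsToRefute d φ` is the case `S = unsatPoly '' {C | C ∈ φ}`
  (`sosFailsToRefute_iff_polySystemSosBlind`). API: antitone in the degree (`….of_le`) and in the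
  system (`….anti`); a system with a genuine `0/1` solution is blind in every degree
  (`polySystemSosBlind_of_boolean_solution`).
* `designSystem v k lam` — the **symmetric `(v,k,λ)`-design system** `D(v,k,λ)`: the polynomial
  identities saying that the `0/1` matrix `(x_{p,B})_{p,B<v}`, cell `(p, B)` being the
  indeterminate `X (p * v + B)` (row `p` = point, column `B` = block), is the incidence matrix of
  a symmetric `(v,k,λ)` design — `AJ = JA = kJ` and, off the diagonal, `AAᵀ = AᵀA = (k-λ)I + λJ`
  (Lander 1983, §1.1): row sums `∑_B x_{p,B} - k`, column sums `∑_p x_{p,B} - k`, point-pair inner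
  products `∑_B x_{p,B} x_{p',B} - λ` (`p ≠ p'`) and block-pair inner products
  `∑_p x_{p,B} x_{p,B'} - λ` (`B ≠ B'`), generated inductively (`DesignIdentity`). The diagonal
  entries `∑_B x_{p,B}² = k` follow from the row sums under Booleanity and are not listed (this
  is the shape of the items of route PneNP/BruckRyserSos). `planeSystem n` is the case
  `(n²+n+1, n+1, 1)`: a projective plane of order `n` (Lander 1983, §1.3).
* `polySystemSosBlind_designSystem_iff` unfolds `PolySystemSosBlind d (designSystem v k lam)` into
  the literal shape of those route items (one `∀`-clause per family of identities), and
  `polySystemSosBlind_designSystem_one_zero` is the sanity check that the trivial symmetric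
  `(v,1,0)` design (singleton blocks, incidence matrix `I`; Lander 1983, §1.1 Example 2) solves
  `designSystem v 1 0`, which is therefore SOS-blind in every degree — the cell indexing
  `X (p * v + B)` decodes as intended and the definitions are not vacuous in the wrong direction.

What is NOT here: no SOS degree lower or upper bound for any design system (those are the cruxes
of route PneNP/BruckRyserSos, not literature), and no non-existence theorem for designs
(Bruck–Ryser–Chowla, Schützenberger's determinant condition), which belong under
`Literature/Combinatorics`. Mathlib's `Configuration.ProjectivePlane` is the incidence-structure
notion of a projective plane; only the arithmetised system is needed here.

## References

* P. K. Kothari, R. Mori, R. O'Donnell, D. Witmer, *Sum of squares lower bounds for refuting any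
  CSP*, STOC 2017, arXiv:1701.04521: Defs. 2.7–2.8 (pseudoexpectations, identities), §2.3 (SOS
  relaxation of a polynomial feasibility problem; "any probability distribution on solutions
  yields a valid degree-`d` pseudoexpectation, for any `d`"). [arXiv170104521]
* E. S. Lander, *Symmetric Designs: An Algebraic Approach*, LMS Lecture Note Series 74, Cambridge
  University Press 1983, doi:10.1017/cbo9780511662164: §1.1 (symmetric `(v,k,λ)` designs; the
  incidence-matrix equations `AJ = JA = kJ`, `AAᵀ = AᵀA = (k-λ)I + λJ`; Example 2, the trivial
  designs `(v,1,0)` and `(v,v-1,v-2)`), §1.3 (projective planes = symmetric designs with `λ = 1`,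
  `PG(2,q)` has parameters `(q²+q+1, q+1, 1)`). [Lander1983]
-/

noncomputable section

open MvPolynomial Literature.Computability.Complexity

namespace Literature.Computability.MetaComplexity

/-! ### SOS blindness for a Boolean polynomial system -/

/-- **Degree-`d` SOS fails to refute the Boolean polynomial system `S`** (degree-`d` SOS "thinks
`{q = 0 : q ∈ S}` has a `0/1` solution"): there is a degree-`d` pseudoexpectation `E`
(`E 1 = 1`, `E p² ≥ 0` for `2 deg p ≤ d`) satisfying in degree `d` every Booleanity identity
`x_w² - x_w = 0`, `w : ℕ`, and every identity `q = 0`, `q ∈ S`. (Kothari–Mori–O'Donnell–Witmer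
2017, §2.3: the degree-`d` SOS relaxation of the feasibility problem `{q = 0 : q ∈ S}` over
Boolean indeterminates is feasible; Defs. 2.7–2.8 for the two notions used. `SOSFailsToRefute` is
the CNF case, `sosFailsToRefute_iff_polySystemSosBlind`.) [cite: arXiv170104521, §2.3] -/
def PolySystemSosBlind (d : ℕ) (S : Set (MvPolynomial ℕ ℝ)) : Prop :=
  ∃ E : MvPolynomial ℕ ℝ →ₗ[ℝ] ℝ, IsPseudoexpectation d E ∧
    (∀ w : ℕ, SatisfiesIdentity d E (boolAxiom w)) ∧ ∀ q ∈ S, SatisfiesIdentity d E q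

/-- Blindness is antitone in the degree: a degree-`d` pseudoexpectation for `S` is a degree-`d'`
one for every `d' ≤ d`, so if degree `d` does not refute `S`, no degree `d' ≤ d` does.
(Kothari–Mori–O'Donnell–Witmer 2017, §2.3.) [folklore] -/
theorem PolySystemSosBlind.of_le {d d' : ℕ} {S : Set (MvPolynomial ℕ ℝ)}
    (h : PolySystemSosBlind d S) (hd : d' ≤ d) : PolySystemSosBlind d' S := by
  obtain ⟨E, ⟨h1, hpsd⟩, hB, hS⟩ := h
  exact ⟨E, ⟨h1, fun p hp => hpsd p (hp.trans hd)⟩, fun w r hr => hB w r (hr.trans hd),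
    fun q hq r hr => hS q hq r (hr.trans hd)⟩

/-- Blindness is antitone in the system: a pseudoexpectation for `T` is one for every `S ⊆ T`.
[folklore] -/
theorem PolySystemSosBlind.anti {d : ℕ} {S T : Set (MvPolynomial ℕ ℝ)}
    (h : PolySystemSosBlind d T) (hST : S ⊆ T) : PolySystemSosBlind d S := by
  obtain ⟨E, hE, hB, hT⟩ := h
  exact ⟨E, hE, hB, fun q hq => hT q (hST hq)⟩

/-- `SOSFailsToRefute d φ` (degree-`d` SOS does not refute the CNF `φ`) is blindness to the system
of clause identities `unsatPoly C = 0`, `C ∈ φ`. (Kothari–Mori–O'Donnell–Witmer 2017, §2.3.)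
[folklore] -/
theorem sosFailsToRefute_iff_polySystemSosBlind {d : ℕ} {φ : CNF ℕ} :
    SOSFailsToRefute d φ ↔ PolySystemSosBlind d (unsatPoly '' {C | C ∈ φ}) := by
  simp only [SOSFailsToRefute, PolySystemSosBlind, Set.forall_mem_image, Set.mem_setOf_eq]

/-- A system with a GENUINE `0/1` solution `x` is refuted in no degree: evaluation at `x` is a
degree-`d` pseudoexpectation satisfying Booleanity and every identity vanishing at `x`.
(Kothari–Mori–O'Donnell–Witmer 2017, §2.3: "any probability distribution on solutions yields a
valid degree-`d` pseudoexpectation, for any `d`".) [folklore] -/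
theorem polySystemSosBlind_of_boolean_solution {d : ℕ} {S : Set (MvPolynomial ℕ ℝ)} (x : ℕ → ℝ)
    (hx : ∀ w, x w = 0 ∨ x w = 1) (h : ∀ q ∈ S, aeval x q = 0) : PolySystemSosBlind d S := by
  refine ⟨(aeval x).toLinearMap, ⟨by simp, fun p _ => ?_⟩, fun w r _ => ?_, fun q hq r _ => ?_⟩
  · simp only [AlgHom.toLinearMap_apply, map_mul]
    exact mul_self_nonneg _
  · simp only [AlgHom.toLinearMap_apply, map_mul, boolAxiom, map_sub, map_pow, aeval_X]
    have hw : x w ^ 2 - x w = 0 := by rcases hx w with h0 | h1 <;> simp [*]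
    rw [hw, zero_mul]
  · simp only [AlgHom.toLinearMap_apply, map_mul]
    rw [h q hq, zero_mul]

/-! ### Symmetric `(v,k,λ)`-design systems -/

/-- The four families of **symmetric `(v,k,λ)`-design identities** in the `0/1` indeterminates
`x_{p,B} = X (p * v + B)`, `p, B < v` (row `p` = point, column `B` = block, so the matrix
`A = (x_{p,B})` is `v × v`): `rowSum p` = "point `p` is on `k` blocks", `∑_{B<v} x_{p,B} - k`;
`colSum B` = "block `B` has `k` points", `∑_{p<v} x_{p,B} - k`; `pointPair p p'` (`p ≠ p'`) =
"two points are on `λ` common blocks", `∑_{B<v} x_{p,B} x_{p',B} - λ`; `blockPair B B'`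
(`B ≠ B'`) = "two blocks meet in `λ` points", `∑_{p<v} x_{p,B} x_{p,B'} - λ`. Together:
`AJ = JA = kJ` and the off-diagonal part of `AAᵀ = AᵀA = (k-λ)I + λJ`, the incidence-matrix form
of the six axioms of a symmetric `(v,k,λ)` design. (Lander 1983, §1.1, the displayed matrix
equations; we do not impose Lander's non-degeneracy `k > λ`.) [cite: Lander1983, §1.1] -/
inductive DesignIdentity (v k lam : ℕ) : MvPolynomial ℕ ℝ → Prop
  /-- point `p < v` is on `k` blocks: `∑_{B<v} x_{p,B} - k`. -/
  | rowSum (p : ℕ) (hp : p < v) :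
      DesignIdentity v k lam ((∑ B ∈ Finset.range v, X (p * v + B)) - C (k : ℝ))
  /-- block `B < v` has `k` points: `∑_{p<v} x_{p,B} - k`. -/
  | colSum (B : ℕ) (hB : B < v) :
      DesignIdentity v k lam ((∑ p ∈ Finset.range v, X (p * v + B)) - C (k : ℝ))
  /-- distinct points `p, p' < v` are on `λ` common blocks: `∑_{B<v} x_{p,B} x_{p',B} - λ`. -/
  | pointPair (p p' : ℕ) (hp : p < v) (hp' : p' < v) (hne : p ≠ p') :
      DesignIdentity v k lam
        ((∑ B ∈ Finset.range v, X (p * v + B) * X (p' * v + B)) - C (lam : ℝ))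
  /-- distinct blocks `B, B' < v` meet in `λ` points: `∑_{p<v} x_{p,B} x_{p,B'} - λ`. -/
  | blockPair (B B' : ℕ) (hB : B < v) (hB' : B' < v) (hne : B ≠ B') :
      DesignIdentity v k lam
        ((∑ p ∈ Finset.range v, X (p * v + B) * X (p * v + B')) - C (lam : ℝ))

/-- The **symmetric `(v,k,λ)`-design system** `D(v,k,λ) ⊆ ℝ[x_0, x_1, …]`: the set of design
identities (`DesignIdentity`) — row sums and column sums `= k`, point-pair and block-pair inner
products `= λ` — of the `v × v` matrix of indeterminates `x_{p,B} = X (p * v + B)`. Its `0/1`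
solutions (cells `≥ v²` being free) are exactly the incidence matrices of symmetric `(v,k,λ)`
designs on points and blocks `0, …, v-1`; "degree-`d` SOS does not refute the existence of a
symmetric `(v,k,λ)` design" is `PolySystemSosBlind d (designSystem v k lam)`.
(Lander 1983, §1.1.) [cite: Lander1983, §1.1] -/
def designSystem (v k lam : ℕ) : Set (MvPolynomial ℕ ℝ) :=
  {q | DesignIdentity v k lam q}

/-- The **projective-plane system of order `n`**: the design system with parameters
`(n² + n + 1, n + 1, 1)` (a projective plane of order `n` is a symmetric design with `λ = 1`,
`k = n + 1`, hence `v = n² + n + 1`; `PG(2,q)` has parameters `(q²+q+1, q+1, 1)`).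
(Lander 1983, §1.3.) [cite: Lander1983, §1.3] -/
abbrev planeSystem (n : ℕ) : Set (MvPolynomial ℕ ℝ) :=
  designSystem (n ^ 2 + n + 1) (n + 1) 1

/-- Row-sum identities belong to the design system. [folklore] -/
theorem rowSum_mem_designSystem {v k lam p : ℕ} (hp : p < v) :
    (∑ B ∈ Finset.range v, X (p * v + B)) - C (k : ℝ) ∈ designSystem v k lam :=
  DesignIdentity.rowSum p hp

/-- Column-sum identities belong to the design system. [folklore] -/
theorem colSum_mem_designSystem {v k lam B : ℕ} (hB : B < v) :
    (∑ p ∈ Finset.range v, X (p * v + B)) - C (k : ℝ) ∈ designSystem v k lam :=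
  DesignIdentity.colSum B hB

/-- Point-pair identities belong to the design system. [folklore] -/
theorem pointPair_mem_designSystem {v k lam p p' : ℕ} (hp : p < v) (hp' : p' < v) (hne : p ≠ p') :
    (∑ B ∈ Finset.range v, X (p * v + B) * X (p' * v + B)) - C (lam : ℝ) ∈ designSystem v k lam :=
  DesignIdentity.pointPair p p' hp hp' hne

/-- Block-pair identities belong to the design system. [folklore] -/
theorem blockPair_mem_designSystem {v k lam B B' : ℕ} (hB : B < v) (hB' : B' < v) (hne : B ≠ B') :
    (∑ p ∈ Finset.range v, X (p * v + B) * X (p * v + B')) - C (lam : ℝ) ∈ designSystem v k lam :=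
  DesignIdentity.blockPair B B' hB hB' hne

/-- Membership unfolding: a property holds throughout `designSystem v k lam` iff it holds for each
of the four families of identities. [folklore] -/
theorem forall_mem_designSystem_iff {v k lam : ℕ} {P : MvPolynomial ℕ ℝ → Prop} :
    (∀ q ∈ designSystem v k lam, P q) ↔
      (∀ p < v, P ((∑ B ∈ Finset.range v, X (p * v + B)) - C (k : ℝ))) ∧
      (∀ B < v, P ((∑ p ∈ Finset.range v, X (p * v + B)) - C (k : ℝ))) ∧
      (∀ p < v, ∀ p' < v, p ≠ p' →
        P ((∑ B ∈ Finset.range v, X (p * v + B) * X (p' * v + B)) - C (lam : ℝ))) ∧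
      (∀ B < v, ∀ B' < v, B ≠ B' →
        P ((∑ p ∈ Finset.range v, X (p * v + B) * X (p * v + B')) - C (lam : ℝ))) := by
  constructor
  · intro h
    exact ⟨fun p hp => h _ (rowSum_mem_designSystem hp),
      fun B hB => h _ (colSum_mem_designSystem hB),
      fun p hp p' hp' hne => h _ (pointPair_mem_designSystem hp hp' hne),
      fun B hB B' hB' hne => h _ (blockPair_mem_designSystem hB hB' hne)⟩
  · rintro ⟨h₁, h₂, h₃, h₄⟩ q hq
    rcases hq with ⟨p, hp⟩ | ⟨B, hB⟩ | ⟨p, p', hp, hp', hne⟩ | ⟨B, B', hB, hB', hne⟩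
    exacts [h₁ p hp, h₂ B hB, h₃ p hp p' hp' hne, h₄ B hB B' hB' hne]

/-- `PolySystemSosBlind d (designSystem v k lam)` in the literal shape of the items of route
PneNP/BruckRyserSos: a degree-`d` pseudoexpectation satisfying Booleanity, the `v` row-sum, the
`v` column-sum, the `v(v-1)` point-pair and the `v(v-1)` block-pair identities. [folklore] -/
theorem polySystemSosBlind_designSystem_iff {d v k lam : ℕ} :
    PolySystemSosBlind d (designSystem v k lam) ↔
      ∃ E : MvPolynomial ℕ ℝ →ₗ[ℝ] ℝ, IsPseudoexpectation d E ∧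
        (∀ w : ℕ, SatisfiesIdentity d E (boolAxiom w)) ∧
        (∀ p < v, SatisfiesIdentity d E ((∑ B ∈ Finset.range v, X (p * v + B)) - C (k : ℝ))) ∧
        (∀ B < v, SatisfiesIdentity d E ((∑ p ∈ Finset.range v, X (p * v + B)) - C (k : ℝ))) ∧
        (∀ p < v, ∀ p' < v, p ≠ p' → SatisfiesIdentity d E
          ((∑ B ∈ Finset.range v, X (p * v + B) * X (p' * v + B)) - C (lam : ℝ))) ∧
        (∀ B < v, ∀ B' < v, B ≠ B' → SatisfiesIdentity d E
          ((∑ p ∈ Finset.range v, X (p * v + B) * X (p * v + B')) - C (lam : ℝ))) :=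
  exists_congr fun _ => and_congr_right fun _ => and_congr_right fun _ =>
    forall_mem_designSystem_iff

/-- SANITY / NON-VACUITY: the trivial symmetric `(v,1,0)` design (blocks = singletons, incidence
matrix `I`) solves `designSystem v 1 0` at the `0/1` point `x_{p,B} = [p = B]` (cell `c` decoding
as `(c / v, c % v)`), so that system is SOS-blind in every degree. (Lander 1983, §1.1
Example 2, the trivial designs; Kothari–Mori–O'Donnell–Witmer 2017, §2.3.)
[cite: Lander1983, §1.1 Example 2] -/
theorem polySystemSosBlind_designSystem_one_zero (d v : ℕ) :
    PolySystemSosBlind d (designSystem v 1 0) := by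
  -- the `0/1` point of the identity matrix: cell `c = p * v + B ↦ [p = B]`
  let x : ℕ → ℝ := fun c => if c / v = c % v then 1 else 0
  have hcell : ∀ p < v, ∀ B < v, x (p * v + B) = if p = B then 1 else 0 := by
    intro p hp B hB
    have hv : 0 < v := lt_of_le_of_lt (Nat.zero_le B) hB
    have h1 : (p * v + B) / v = p := by
      rw [Nat.add_comm, Nat.add_mul_div_right B p hv, Nat.div_eq_of_lt hB, Nat.zero_add]
    have h2 : (p * v + B) % v = B := by
      rw [Nat.add_comm, Nat.add_mul_mod_self_right, Nat.mod_eq_of_lt hB]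
    simp only [x, h1, h2]
  refine polySystemSosBlind_of_boolean_solution x (fun c => ?_) ?_
  · by_cases hc : c / v = c % v <;> simp [x, hc]
  · rw [forall_mem_designSystem_iff]
    refine ⟨fun p hp => ?_, fun B hB => ?_, fun p hp p' hp' hne => ?_, fun B hB B' hB' hne => ?_⟩
    · -- row `p`: `∑_B [p = B] = 1`
      simp only [map_sub, map_sum, aeval_X, Nat.cast_one, map_one]
      rw [Finset.sum_congr rfl fun B hB => hcell p hp B (Finset.mem_range.1 hB),
        Finset.sum_ite_eq, if_pos (Finset.mem_range.2 hp), sub_self]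
    · -- column `B`: `∑_p [p = B] = 1`
      simp only [map_sub, map_sum, aeval_X, Nat.cast_one, map_one]
      rw [Finset.sum_congr rfl fun p hp => hcell p (Finset.mem_range.1 hp) B hB,
        Finset.sum_ite_eq', if_pos (Finset.mem_range.2 hB), sub_self]
    · -- distinct points share no block of the trivial design
      simp only [map_sum, map_mul, aeval_X, Nat.cast_zero, map_zero, sub_zero]
      refine Finset.sum_eq_zero fun B hB => ?_
      rw [hcell p hp B (Finset.mem_range.1 hB), hcell p' hp' B (Finset.mem_range.1 hB)]
      by_cases h : p = B
      · have h' : p' ≠ B := fun h' => hne (h.trans h'.symm)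
        simp [h, h']
      · simp [h]
    · -- distinct blocks share no point
      simp only [map_sum, map_mul, aeval_X, Nat.cast_zero, map_zero, sub_zero]
      refine Finset.sum_eq_zero fun p hp => ?_
      rw [hcell p (Finset.mem_range.1 hp) B hB, hcell p (Finset.mem_range.1 hp) B' hB']
      by_cases h : p = B
      · simp [h, hne]
      · simp [h]

end Literature.Computability.MetaComplexity
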